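import Mathlib
import Summits.MatrixMultiplication.MatrixMultiplication.Theorems.FidelityWitnessesFidelityThesisStubGeneralMajorantLaw
import Summits.MatrixMultiplication.MatrixMultiplication.Theorems.FidelityWitnessesFidelityThesisStubChirpInjectiveNorm
import Literature.Computability.AlgebraicComplexity.AlderStrassen
import Literature.Computability.AlgebraicComplexity.AlderStrassenProofs

/-!
# Line `Sketch` (separable-majorant) for crux `FidelityWitnesses.FidelityThesis` (stmt-MatrixMultiplication-4956) —
ROBUSTNESS GROWTH forces superlinear (border) rank of the explicit CHIRP TENSORS (registered node `chirpRank_of_robustnessGrowthAt`)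

ROBUSTNESS GROWTH RG(δ′, C) was the open stub of lead -0's skeleton: every span of `r` products `u_l ⊗ v_l ⊂ ℂ^{n×n} ⊗ ℂ^{n×n}`
(every `n`) admits a sub-normalised separable majorant of weight `λ ≤ C·r^{3/2−δ′}` (projector-free form below).  It implies the
crux with `δ = 4δ′/(3−2δ′)` (landed `fidelityThesis_of_robustnessGrowth`).  This file shows it is STRICTLY more than the crux
needs, by extracting from it superlinear rank lower bounds for an explicit family of tensors unrelated to matrix multiplication:

* the CHIRP TENSORS `Z_N(k,b,c) = [b = c + k]·e(k²c)` on `(ℤ/N)³`, `N` an odd prime, `e = ZMod.stdAddChar` (output slices = the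
  `N` Weyl unitaries `Z^{k²}X^k`, one from each non-vertical line of `(ℤ/N)²`): mass `N²` (`chirp_normSq`) and injective norm²
  `≤ √(2N−1)` (landed `stub_chirpInjectiveNorm`: Gram–Schur + Weyl–Parseval + parabola bijection);
* `chirpRank_of_robustnessGrowthAt`: RG(δ′, C) ⟹ `N^{3/2}/(√2·C) ≤ R(Z_N)^{3/2−δ′}`, i.e. `R(Z_N) ≥ c·N^{1+δ′/(3/2−δ′)}`;
* `chirpBorderRank_of_robustnessGrowthAt`: the same for the border rank `R̲(Z_N)` (Alder–Strassen closure form + continuity).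

Mechanism: the T-free separable majorant law (landed `stub_generalMajorantLaw`) bounds `|⟨S, Z⟩|²` by `λ·‖Z‖_σ²·‖S‖²` for every
test tensor `Z`; pairing the zero-padded chirp with its own conjugate gives `N⁴ ≤ C·R^{3/2−δ′}·√(2N−1)·N²`.  Helpers (all
[folklore]): zero-padding into a product format does not increase rank (`tensorRank_pad_le`) and is invisible to product pairings
(`pad_pairing_eq`, `pad_normSq_eq`); RG is invariant under relabelling the input index type (`robustnessGrowthAt_transport`).
Superlinear rank lower bounds for explicit `N×N×N` tensors are open in general (best unconditional bounds are linear); this one is not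
known to follow from `ω(ℂ) > 2` (⟺ the crux).  Numerics (kit j016217): ALS puts `R̲(Z_N)` at the generic value (5, 10, 19, > 40 for
`N = 3, 5, 7, 11`), `‖Z_N‖_σ² ≈ 2.0–4.0` for `N ≤ 23`.  Supports item `stmt-MatrixMultiplication-4956`; no definitions. -/

namespace Summit.MatrixMultiplication.MatrixMultiplication.Theorems

open scoped BigOperators ComplexConjugate
open Literature.Computability.AlgebraicComplexity

/-- **Zero-padding does not increase tensor rank**: the tensor on `(α × α') × (β × β') × (γ × γ')` equal to `t a.1 b.1 c.1` on
the slice `a.2 = a₀, b.2 = b₀, c.2 = c₀` and `0` elsewhere has rank `≤ R(t)` (pad an optimal decomposition). [folklore] -/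
theorem tensorRank_pad_le {α β γ α' β' γ' : Type} [Fintype α] [Fintype β] [Fintype γ]
    [DecidableEq α'] [DecidableEq β'] [DecidableEq γ'] (t : α → β → γ → ℂ) (a₀ : α') (b₀ : β') (c₀ : γ') :
    tensorRank (fun (a : α × α') (b : β × β') (c : γ × γ') =>
        if a.2 = a₀ ∧ b.2 = b₀ ∧ c.2 = c₀ then t a.1 b.1 c.1 else 0) ≤ tensorRank t := by
  classical
  obtain ⟨w, u, v, h⟩ := exists_eq_sum_triad_of_tensorRank_le (le_refl (tensorRank t))
  refine tensorRank_le_of_eq_sum (fun i a => if a.2 = a₀ then w i a.1 else 0)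
    (fun i b => if b.2 = b₀ then u i b.1 else 0) (fun i c => if c.2 = c₀ then v i c.1 else 0) ?_
  funext a b c
  rw [Finset.sum_apply, Finset.sum_apply, Finset.sum_apply]
  simp only [triad_apply]
  by_cases ha : a.2 = a₀
  · by_cases hb : b.2 = b₀
    · by_cases hc : c.2 = c₀
      · simp only [ha, hb, hc, and_self, if_true]
        have h' := congrFun (congrFun (congrFun h a.1) b.1) c.1
        rw [h', Finset.sum_apply, Finset.sum_apply, Finset.sum_apply]
        simp only [triad_apply]
      · simp [hc]
    · simp [hb]
  · simp [ha]

/-- **Pairing a padded tensor with a product `f ⊗ g` only sees the slice** (restrictions `f(·, b₀)`, `g(·, c₀)`). [folklore] -/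
theorem pad_pairing_eq {α β γ α' β' γ' : Type*} [Fintype α] [Fintype β] [Fintype γ] [Fintype α'] [Fintype β']
    [Fintype γ'] [DecidableEq α'] [DecidableEq β'] [DecidableEq γ'] (t : α → β → γ → ℂ) (a₀ : α') (b₀ : β')
    (c₀ : γ') (f : β × β' → ℂ) (g : γ × γ' → ℂ) :
    ∑ a : α × α', ‖∑ b : β × β', ∑ c : γ × γ',
        f b * g c * (if a.2 = a₀ ∧ b.2 = b₀ ∧ c.2 = c₀ then t a.1 b.1 c.1 else 0)‖ ^ 2 =
      ∑ a : α, ‖∑ b : β, ∑ c : γ, f (b, b₀) * g (c, c₀) * t a b c‖ ^ 2 := by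
  classical
  have hinner : ∀ a : α × α',
      (∑ b : β × β', ∑ c : γ × γ',
        f b * g c * (if a.2 = a₀ ∧ b.2 = b₀ ∧ c.2 = c₀ then t a.1 b.1 c.1 else 0)) =
        if a.2 = a₀ then ∑ b : β, ∑ c : γ, f (b, b₀) * g (c, c₀) * t a.1 b c else 0 := by
    intro a
    by_cases ha : a.2 = a₀
    · simp only [ha, true_and, ite_and, mul_ite, mul_zero, if_true]
      simp_rw [Fintype.sum_prod_type]
      simp only [Finset.sum_ite_irrel, Finset.sum_const_zero, Finset.sum_ite_eq', Finset.mem_univ, if_true]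
    · simp [ha]
  simp_rw [hinner]
  rw [Fintype.sum_prod_type]
  refine Finset.sum_congr rfl fun a _ => ?_
  rw [Finset.sum_eq_single a₀]
  · simp
  · intro a' _ hne
    simp [hne]
  · simp

/-- **Squared mass of a padded tensor** equals that of the tensor. [folklore] -/
theorem pad_normSq_eq {α β γ α' β' γ' : Type*} [Fintype α] [Fintype β] [Fintype γ] [Fintype α'] [Fintype β']
    [Fintype γ'] [DecidableEq α'] [DecidableEq β'] [DecidableEq γ'] (t : α → β → γ → ℂ) (a₀ : α') (b₀ : β')
    (c₀ : γ') :
    ∑ a : α × α', ∑ b : β × β', ∑ c : γ × γ',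
        ‖(if a.2 = a₀ ∧ b.2 = b₀ ∧ c.2 = c₀ then t a.1 b.1 c.1 else 0)‖ ^ 2 =
      ∑ a : α, ∑ b : β, ∑ c : γ, ‖t a b c‖ ^ 2 := by
  classical
  simp only [apply_ite norm, ite_pow, norm_zero, ne_eq, OfNat.ofNat_ne_zero, not_false_eq_true, zero_pow,
    ite_and]
  simp_rw [Fintype.sum_prod_type]
  simp only [Finset.sum_ite_irrel, Finset.sum_const_zero, Finset.sum_ite_eq', Finset.mem_univ, if_true]

/-- `Σ_x F x · conj(F x) = Σ_x ‖F x‖²` (as a complex number). [folklore] -/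
theorem sum_mul_conj_eq_normSq {ι : Type*} [Fintype ι] (F : ι → ℂ) :
    ∑ x, F x * conj (F x) = ((∑ x, ‖F x‖ ^ 2 : ℝ) : ℂ) := by
  push_cast
  refine Finset.sum_congr rfl fun x _ => ?_
  rw [Complex.mul_conj, Complex.normSq_eq_norm_sq]
  push_cast
  ring

/-- A partial sum of squares over a slice is at most the full sum. [folklore] -/
theorem sum_slice_normSq_le {β β' : Type*} [Fintype β] [Fintype β'] [DecidableEq β'] (f : β × β' → ℂ) (b₀ : β') :
    ∑ b : β, ‖f (b, b₀)‖ ^ 2 ≤ ∑ b : β × β', ‖f b‖ ^ 2 := by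
  rw [Fintype.sum_prod_type]
  refine Finset.sum_le_sum fun b _ => ?_
  exact Finset.single_le_sum (f := fun b' => ‖f (b, b')‖ ^ 2) (fun _ _ => by positivity) (Finset.mem_univ b₀)

/-- **Mass of the chirp tensor**: `Σ_{k,b,c} |Z_N(k,b,c)|² = N²` (one unimodular entry for each `(k, c)`). [folklore] -/
theorem chirp_normSq {N : ℕ} [NeZero N] :
    ∑ k : ZMod N, ∑ b : ZMod N, ∑ c : ZMod N,
        ‖(if b = c + k then (ZMod.stdAddChar (k ^ 2 * c) : ℂ) else 0)‖ ^ 2 = (N : ℝ) ^ 2 := by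
  have hone : ∀ x : ZMod N, ‖(ZMod.stdAddChar x : ℂ)‖ = 1 := fun x => by
    rw [ZMod.stdAddChar_apply]; exact Circle.norm_coe _
  simp only [apply_ite norm, ite_pow, hone, one_pow, norm_zero, ne_eq, OfNat.ofNat_ne_zero,
    not_false_eq_true, zero_pow]
  have hinner : ∀ k : ZMod N, (∑ b : ZMod N, ∑ c : ZMod N, (if b = c + k then (1 : ℝ) else 0)) = N := by
    intro k
    rw [Finset.sum_comm]
    simp only [Finset.sum_ite_eq', Finset.mem_univ, if_true, Finset.sum_const, Finset.card_univ, ZMod.card,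
      nsmul_eq_mul, mul_one]
  simp only [hinner, Finset.sum_const, Finset.card_univ, ZMod.card, nsmul_eq_mul]
  ring

/-- **Injective-norm bound of the conjugate padded chirp tensor** (from `stub_chirpInjectiveNorm`): for the zero-padding `Zp`
of `Z_N` into `(ℤ/N × ℤ/N)³` and all `f, g`, `Σ_a |Σ_{b,c} f b · g c · conj(Zp a b c)|² ≤ √(2N−1)·‖f‖²·‖g‖²`. [folklore] -/
theorem chirpPad_conj_injective {N : ℕ} [Fact (Nat.Prime N)] (hN : N ≠ 2)
    (f g : ZMod N × ZMod N → ℂ) :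
    ∑ a : ZMod N × ZMod N, ‖∑ b : ZMod N × ZMod N, ∑ c : ZMod N × ZMod N,
        f b * g c * conj ((if a.2 = 0 ∧ b.2 = 0 ∧ c.2 = 0 then
          (if b.1 = c.1 + a.1 then (ZMod.stdAddChar (a.1 ^ 2 * c.1) : ℂ) else 0) else 0))‖ ^ 2 ≤
      Real.sqrt (2 * N - 1) * ((∑ b, ‖f b‖ ^ 2) * ∑ c, ‖g c‖ ^ 2) := by
  classical
  have hconj : ∀ a : ZMod N × ZMod N,
      (∑ b : ZMod N × ZMod N, ∑ c : ZMod N × ZMod N,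
        f b * g c * conj ((if a.2 = 0 ∧ b.2 = 0 ∧ c.2 = 0 then
          (if b.1 = c.1 + a.1 then (ZMod.stdAddChar (a.1 ^ 2 * c.1) : ℂ) else 0) else 0))) =
        conj (∑ b : ZMod N × ZMod N, ∑ c : ZMod N × ZMod N,
          conj (f b) * conj (g c) * (if a.2 = 0 ∧ b.2 = 0 ∧ c.2 = 0 then
            (if b.1 = c.1 + a.1 then (ZMod.stdAddChar (a.1 ^ 2 * c.1) : ℂ) else 0) else 0)) := by
    intro a
    rw [map_sum]
    refine Finset.sum_congr rfl fun b _ => ?_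
    rw [map_sum]
    refine Finset.sum_congr rfl fun c _ => ?_
    simp only [map_mul, Complex.conj_conj]
  simp_rw [hconj, Complex.norm_conj]
  rw [pad_pairing_eq (fun (k b c : ZMod N) => if b = c + k then (ZMod.stdAddChar (k ^ 2 * c) : ℂ) else 0)
    (0 : ZMod N) (0 : ZMod N) (0 : ZMod N) (fun b => conj (f b)) (fun c => conj (g c))]
  have hchirp := stub_chirpInjectiveNorm hN (fun b => conj (f (b, 0))) (fun c => conj (g (c, 0)))
  simp only [Complex.norm_conj] at hchirp
  have hf : ∑ b : ZMod N, ‖f (b, 0)‖ ^ 2 ≤ ∑ b, ‖f b‖ ^ 2 := sum_slice_normSq_le f 0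
  have hg : ∑ c : ZMod N, ‖g (c, 0)‖ ^ 2 ≤ ∑ c, ‖g c‖ ^ 2 := sum_slice_normSq_le g 0
  have hf0 : 0 ≤ ∑ b : ZMod N, ‖f (b, 0)‖ ^ 2 := Finset.sum_nonneg fun _ _ => by positivity
  have hg0 : 0 ≤ ∑ c : ZMod N, ‖g (c, 0)‖ ^ 2 := Finset.sum_nonneg fun _ _ => by positivity
  calc _ ≤ Real.sqrt (2 * N - 1) * ((∑ b : ZMod N, ‖f (b, 0)‖ ^ 2) * ∑ c : ZMod N, ‖g (c, 0)‖ ^ 2) := hchirp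
    _ ≤ Real.sqrt (2 * N - 1) * ((∑ b, ‖f b‖ ^ 2) * ∑ c, ‖g c‖ ^ 2) := by
        apply mul_le_mul_of_nonneg_left _ (Real.sqrt_nonneg _)
        exact mul_le_mul hf hg hg0 (hf0.trans hf)

/-- **Robustness growth is invariant under relabelling the input index type** (`ι ≃ Fin n × Fin n`; all sums reindex along
the equivalence). [folklore] -/
theorem robustnessGrowthAt_transport {δ' C : ℝ} {n : ℕ} {ι : Type*} [Fintype ι] (e : ι ≃ Fin n × Fin n)
    (hRG : ∀ (r : ℕ) (u v : Fin r → Fin n × Fin n → ℂ),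
      ∃ (m : ℕ) (p : Fin m → ℝ) (φ ψ : Fin m → Fin n × Fin n → ℂ) (lam : ℝ),
        0 ≤ lam ∧ lam ≤ C * (r : ℝ) ^ (3 / 2 - δ') ∧ (∀ k, 0 ≤ p k) ∧
        (∑ k, p k * ((∑ b, ‖φ k b‖ ^ 2) * ∑ c, ‖ψ k c‖ ^ 2) ≤ 1) ∧
        ∀ (d : Fin r → ℂ) (z : Fin n × Fin n → Fin n × Fin n → ℂ),
          ‖∑ b, ∑ c, (∑ l, d l * u l b * v l c) * z b c‖ ^ 2 ≤
            lam * (∑ b, ∑ c, ‖∑ l, d l * u l b * v l c‖ ^ 2) *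
              ∑ k, p k * ‖∑ b, ∑ c, φ k b * ψ k c * z b c‖ ^ 2)
    (r : ℕ) (u v : Fin r → ι → ℂ) :
    ∃ (m : ℕ) (p : Fin m → ℝ) (φ ψ : Fin m → ι → ℂ) (lam : ℝ),
      0 ≤ lam ∧ lam ≤ C * (r : ℝ) ^ (3 / 2 - δ') ∧ (∀ k, 0 ≤ p k) ∧
      (∑ k, p k * ((∑ b, ‖φ k b‖ ^ 2) * ∑ c, ‖ψ k c‖ ^ 2) ≤ 1) ∧
      ∀ (d : Fin r → ℂ) (z : ι → ι → ℂ),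
        ‖∑ b, ∑ c, (∑ l, d l * u l b * v l c) * z b c‖ ^ 2 ≤
          lam * (∑ b, ∑ c, ‖∑ l, d l * u l b * v l c‖ ^ 2) *
            ∑ k, p k * ‖∑ b, ∑ c, φ k b * ψ k c * z b c‖ ^ 2 := by
  obtain ⟨m, p, φ', ψ', lam, h0, hle, hp, htr, hmaj⟩ :=
    hRG r (fun l x => u l (e.symm x)) (fun l x => v l (e.symm x))
  refine ⟨m, p, fun k i => φ' k (e i), fun k i => ψ' k (e i), lam, h0, hle, hp, ?_, ?_⟩
  · -- trace: reindex each single sum along `e`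
    have hφ : ∀ k, (∑ b : ι, ‖φ' k (e b)‖ ^ 2) = ∑ x, ‖φ' k x‖ ^ 2 := fun k =>
      e.sum_comp (fun x => ‖φ' k x‖ ^ 2)
    have hψ : ∀ k, (∑ c : ι, ‖ψ' k (e c)‖ ^ 2) = ∑ x, ‖ψ' k x‖ ^ 2 := fun k =>
      e.sum_comp (fun x => ‖ψ' k x‖ ^ 2)
    simp_rw [hφ, hψ]
    exact htr
  · intro d z
    have key := hmaj d (fun x y => z (e.symm x) (e.symm y))
    have h2 : ∀ (F : Fin n × Fin n → Fin n × Fin n → ℂ),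
        (∑ x, ∑ y, F x y) = ∑ b : ι, ∑ c : ι, F (e b) (e c) := by
      intro F
      rw [← e.sum_comp (fun x => ∑ y, F x y)]
      refine Finset.sum_congr rfl fun b _ => ?_
      rw [← e.sum_comp (fun y => F (e b) y)]
    have h2r : ∀ (F : Fin n × Fin n → Fin n × Fin n → ℝ),
        (∑ x, ∑ y, F x y) = ∑ b : ι, ∑ c : ι, F (e b) (e c) := by
      intro F
      rw [← e.sum_comp (fun x => ∑ y, F x y)]
      refine Finset.sum_congr rfl fun b _ => ?_
      rw [← e.sum_comp (fun y => F (e b) y)]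
    rw [h2, h2r] at key
    simp only [Equiv.symm_apply_apply] at key
    have h3 : ∀ k, (∑ x, ∑ y, φ' k x * ψ' k y * z (e.symm x) (e.symm y)) =
        ∑ b : ι, ∑ c : ι, φ' k (e b) * ψ' k (e c) * z b c := by
      intro k
      rw [h2]
      simp only [Equiv.symm_apply_apply]
    simp_rw [h3] at key
    exact key

/-- **The padded chirp law**: under robustness growth at `(δ′, C)`, every `S` on `(ℤ/N × ℤ/N)³` of rank `≤ R` pairs with the
conjugate zero-padded chirp `Zp` by at most `C·R^{3/2−δ′}·√(2N−1)·‖S‖²` (transport RG, decompose `S` into `R` triads,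
`stub_generalMajorantLaw` with test tensor `conj Zp`, injective bound from `chirpPad_conj_injective`). [folklore] -/
theorem chirpPad_pairing_le {δ' C : ℝ}
    (hRG : ∀ (n r : ℕ) (u v : Fin r → Fin n × Fin n → ℂ),
      ∃ (m : ℕ) (p : Fin m → ℝ) (φ ψ : Fin m → Fin n × Fin n → ℂ) (lam : ℝ),
        0 ≤ lam ∧ lam ≤ C * (r : ℝ) ^ (3 / 2 - δ') ∧ (∀ k, 0 ≤ p k) ∧
        (∑ k, p k * ((∑ b, ‖φ k b‖ ^ 2) * ∑ c, ‖ψ k c‖ ^ 2) ≤ 1) ∧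
        ∀ (d : Fin r → ℂ) (z : Fin n × Fin n → Fin n × Fin n → ℂ),
          ‖∑ b, ∑ c, (∑ l, d l * u l b * v l c) * z b c‖ ^ 2 ≤
            lam * (∑ b, ∑ c, ‖∑ l, d l * u l b * v l c‖ ^ 2) *
              ∑ k, p k * ‖∑ b, ∑ c, φ k b * ψ k c * z b c‖ ^ 2)
    (N : ℕ) [Fact (Nat.Prime N)] (hN : N ≠ 2) (R : ℕ)
    (S : ZMod N × ZMod N → ZMod N × ZMod N → ZMod N × ZMod N → ℂ) (hS : tensorRank S ≤ R) :
    ‖∑ a, ∑ b, ∑ c, S a b c * conj ((if a.2 = 0 ∧ b.2 = 0 ∧ c.2 = 0 then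
        (if b.1 = c.1 + a.1 then (ZMod.stdAddChar (a.1 ^ 2 * c.1) : ℂ) else 0) else 0))‖ ^ 2 ≤
      C * (R : ℝ) ^ (3 / 2 - δ') * Real.sqrt (2 * N - 1) * ∑ a, ∑ b, ∑ c, ‖S a b c‖ ^ 2 := by
  classical
  obtain ⟨w, u, v, hdec⟩ := exists_eq_sum_triad_of_tensorRank_le hS
  have hdec' : ∀ a b c, S a b c = ∑ l, w l a * u l b * v l c := by
    intro a b c
    have h' := congrFun (congrFun (congrFun hdec a) b) c
    rw [h', Finset.sum_apply, Finset.sum_apply, Finset.sum_apply]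
    simp only [triad_apply]
  haveI : NeZero N := ⟨(Fact.out : N.Prime).ne_zero⟩
  have hcard : Fintype.card (ZMod N × ZMod N) = Fintype.card (Fin N × Fin N) := by
    simp [Fintype.card_prod, ZMod.card]
  let e : ZMod N × ZMod N ≃ Fin N × Fin N := Fintype.equivOfCardEq hcard
  obtain ⟨m, p, φ, ψ, lam, hlam0, hlamle, hp, htr, hmaj⟩ :=
    robustnessGrowthAt_transport e (hRG N) R u v
  have hK : 0 ≤ Real.sqrt (2 * N - 1) := Real.sqrt_nonneg _
  have hlaw := stub_generalMajorantLaw w u v p φ ψ lam (Real.sqrt (2 * N - 1)) hlam0 hK hp htr hmaj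
    (fun a b c => conj ((if a.2 = 0 ∧ b.2 = 0 ∧ c.2 = 0 then
        (if b.1 = c.1 + a.1 then (ZMod.stdAddChar (a.1 ^ 2 * c.1) : ℂ) else 0) else 0)))
    (fun f g => chirpPad_conj_injective hN f g)
  have hmass0 : 0 ≤ ∑ a, ∑ b, ∑ c, ‖∑ l, w l a * u l b * v l c‖ ^ 2 :=
    Finset.sum_nonneg fun _ _ => Finset.sum_nonneg fun _ _ => Finset.sum_nonneg fun _ _ => by positivity
  simp_rw [hdec']
  calc _ ≤ lam * Real.sqrt (2 * N - 1) * ∑ a, ∑ b, ∑ c, ‖∑ l, w l a * u l b * v l c‖ ^ 2 := hlaw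
    _ ≤ C * (R : ℝ) ^ (3 / 2 - δ') * Real.sqrt (2 * N - 1) * ∑ a, ∑ b, ∑ c, ‖∑ l, w l a * u l b * v l c‖ ^ 2 :=
        mul_le_mul_of_nonneg_right (mul_le_mul_of_nonneg_right hlamle hK) hmass0

/-- **The padded chirp law at the chirp itself**, `N⁴ ≤ C·ρ·√(2N−1)·N²`, gives `N^{3/2}/(√2·C) ≤ ρ`. [folklore] -/
theorem chirp_selfPairing_arith {C ρ : ℝ} (hC : 0 < C) (hρ : 0 ≤ ρ) {N : ℕ} [Fact (Nat.Prime N)] (hN : N ≠ 2)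
    (h : ‖∑ a : ZMod N × ZMod N, ∑ b : ZMod N × ZMod N, ∑ c : ZMod N × ZMod N,
        (if a.2 = 0 ∧ b.2 = 0 ∧ c.2 = 0 then
          (if b.1 = c.1 + a.1 then (ZMod.stdAddChar (a.1 ^ 2 * c.1) : ℂ) else 0) else 0) *
        conj ((if a.2 = 0 ∧ b.2 = 0 ∧ c.2 = 0 then
          (if b.1 = c.1 + a.1 then (ZMod.stdAddChar (a.1 ^ 2 * c.1) : ℂ) else 0) else 0))‖ ^ 2 ≤
      C * ρ * Real.sqrt (2 * N - 1) * ∑ a : ZMod N × ZMod N, ∑ b : ZMod N × ZMod N, ∑ c : ZMod N × ZMod N,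
        ‖(if a.2 = 0 ∧ b.2 = 0 ∧ c.2 = 0 then
          (if b.1 = c.1 + a.1 then (ZMod.stdAddChar (a.1 ^ 2 * c.1) : ℂ) else 0) else 0)‖ ^ 2) :
    (N : ℝ) ^ (3 / 2 : ℝ) / (Real.sqrt 2 * C) ≤ ρ := by
  classical
  haveI : NeZero N := ⟨(Fact.out : N.Prime).ne_zero⟩
  set Zc : ZMod N → ZMod N → ZMod N → ℂ := fun k b c =>
    if b = c + k then (ZMod.stdAddChar (k ^ 2 * c) : ℂ) else 0 with hZc
  set Zp : ZMod N × ZMod N → ZMod N × ZMod N → ZMod N × ZMod N → ℂ := fun a b c =>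
    if a.2 = 0 ∧ b.2 = 0 ∧ c.2 = 0 then Zc a.1 b.1 c.1 else 0 with hZp
  set M : ℝ := ∑ a, ∑ b, ∑ c, ‖Zp a b c‖ ^ 2 with hM
  have hMeq : M = (N : ℝ) ^ 2 := by
    rw [hM, hZp, pad_normSq_eq Zc 0 0 0, hZc]
    exact chirp_normSq
  have hpair : (∑ a, ∑ b, ∑ c, Zp a b c * conj (Zp a b c)) = (M : ℂ) := by
    rw [hM]
    push_cast
    refine Finset.sum_congr rfl fun a _ => Finset.sum_congr rfl fun b _ => ?_
    rw [sum_mul_conj_eq_normSq (fun c => Zp a b c)]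
    push_cast
    rfl
  change ‖∑ a, ∑ b, ∑ c, Zp a b c * conj (Zp a b c)‖ ^ 2 ≤ C * ρ * Real.sqrt (2 * N - 1) * M at h
  rw [hpair, Complex.norm_real, Real.norm_of_nonneg (by rw [hMeq]; positivity)] at h
  have hN3 : (3 : ℝ) ≤ N := by
    have h2 := (Fact.out : N.Prime).two_le
    have : 3 ≤ N := by omega
    exact_mod_cast this
  have hMpos : 0 < M := by rw [hMeq]; positivity
  have hK : 0 ≤ Real.sqrt (2 * N - 1) := Real.sqrt_nonneg _
  have h1 : M ≤ C * ρ * Real.sqrt (2 * N - 1) := by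
    have : M * M ≤ C * ρ * Real.sqrt (2 * N - 1) * M := by nlinarith [h]
    exact le_of_mul_le_mul_right this hMpos
  have hsqrt : Real.sqrt (2 * N - 1) ≤ Real.sqrt 2 * Real.sqrt N := by
    rw [← Real.sqrt_mul (by norm_num)]
    exact Real.sqrt_le_sqrt (by linarith)
  have hNpos : (0 : ℝ) < N := by linarith
  have hsqrtN : 0 < Real.sqrt N := Real.sqrt_pos.2 hNpos
  have h3 : (N : ℝ) ^ 2 ≤ C * ρ * (Real.sqrt 2 * Real.sqrt N) := by
    rw [← hMeq]
    exact h1.trans (mul_le_mul_of_nonneg_left hsqrt (by positivity))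
  have h32 : (N : ℝ) ^ (3 / 2 : ℝ) = (N : ℝ) ^ 2 / Real.sqrt N := by
    rw [eq_div_iff hsqrtN.ne', Real.sqrt_eq_rpow, ← Real.rpow_add hNpos]
    norm_num
  rw [h32, div_div, div_le_iff₀ (by positivity)]
  calc (N : ℝ) ^ 2 ≤ C * ρ * (Real.sqrt 2 * Real.sqrt N) := h3
    _ = ρ * (Real.sqrt N * (Real.sqrt 2 * C)) := by ring

/-- **ROBUSTNESS GROWTH ⟹ SUPERLINEAR RANK FOR THE CHIRP TENSORS.** Under robustness growth at `(δ′, C)` (lead -0's stub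
shape, spelled out), for every odd prime `N` the chirp tensor `Z_N(k,b,c) = [b = c + k]·e(k²c)` on `(ℤ/N)³` satisfies
`N^{3/2}/(√2·C) ≤ R(Z_N)^{3/2−δ′}`, i.e. `R(Z_N) ≥ c·N^{1+δ′/(3/2−δ′)}` — superlinear, for an explicit family other than matrix
multiplication.  Pad `Z_N` by zero into `(ℤ/N × ℤ/N)³` (`tensorRank_pad_le`), apply `chirpPad_pairing_le` to the padded tensor
itself and finish with `chirp_selfPairing_arith`. [folklore] -/
theorem chirpRank_of_robustnessGrowthAt {δ' C : ℝ} (hC : 0 < C)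
    (hRG : ∀ (n r : ℕ) (u v : Fin r → Fin n × Fin n → ℂ),
      ∃ (m : ℕ) (p : Fin m → ℝ) (φ ψ : Fin m → Fin n × Fin n → ℂ) (lam : ℝ),
        0 ≤ lam ∧ lam ≤ C * (r : ℝ) ^ (3 / 2 - δ') ∧ (∀ k, 0 ≤ p k) ∧
        (∑ k, p k * ((∑ b, ‖φ k b‖ ^ 2) * ∑ c, ‖ψ k c‖ ^ 2) ≤ 1) ∧
        ∀ (d : Fin r → ℂ) (z : Fin n × Fin n → Fin n × Fin n → ℂ),
          ‖∑ b, ∑ c, (∑ l, d l * u l b * v l c) * z b c‖ ^ 2 ≤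
            lam * (∑ b, ∑ c, ‖∑ l, d l * u l b * v l c‖ ^ 2) *
              ∑ k, p k * ‖∑ b, ∑ c, φ k b * ψ k c * z b c‖ ^ 2)
    (N : ℕ) [Fact (Nat.Prime N)] (hN : N ≠ 2) :
    (N : ℝ) ^ (3 / 2 : ℝ) / (Real.sqrt 2 * C) ≤
      (tensorRank (fun k b c : ZMod N =>
          if b = c + k then (ZMod.stdAddChar (k ^ 2 * c) : ℂ) else 0) : ℝ) ^ (3 / 2 - δ') := by
  classical
  set Zc : ZMod N → ZMod N → ZMod N → ℂ := fun k b c =>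
    if b = c + k then (ZMod.stdAddChar (k ^ 2 * c) : ℂ) else 0 with hZc
  have hpadR : tensorRank (fun (a b c : ZMod N × ZMod N) =>
      if a.2 = 0 ∧ b.2 = 0 ∧ c.2 = 0 then Zc a.1 b.1 c.1 else 0) ≤ tensorRank Zc :=
    tensorRank_pad_le Zc 0 0 0
  have hlaw := chirpPad_pairing_le hRG N hN (tensorRank Zc) _ hpadR
  exact chirp_selfPairing_arith hC (Real.rpow_nonneg (Nat.cast_nonneg _) _) hN hlaw

/-- **… and for their BORDER rank**: `N^{3/2}/(√2·C) ≤ R̲(Z_N)^{3/2−δ′}` (`R̲ = algBorderRank`): the padded chirp law is a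
closed condition in `S`, `Z_N` is a limit of tensors of rank `≤ R̲(Z_N)` (Alder–Strassen, `mem_closure_setOf_tensorRank_le_iff`),
and zero-padding is continuous and rank-monotone. [folklore] -/
theorem chirpBorderRank_of_robustnessGrowthAt {δ' C : ℝ} (hC : 0 < C)
    (hRG : ∀ (n r : ℕ) (u v : Fin r → Fin n × Fin n → ℂ),
      ∃ (m : ℕ) (p : Fin m → ℝ) (φ ψ : Fin m → Fin n × Fin n → ℂ) (lam : ℝ),
        0 ≤ lam ∧ lam ≤ C * (r : ℝ) ^ (3 / 2 - δ') ∧ (∀ k, 0 ≤ p k) ∧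
        (∑ k, p k * ((∑ b, ‖φ k b‖ ^ 2) * ∑ c, ‖ψ k c‖ ^ 2) ≤ 1) ∧
        ∀ (d : Fin r → ℂ) (z : Fin n × Fin n → Fin n × Fin n → ℂ),
          ‖∑ b, ∑ c, (∑ l, d l * u l b * v l c) * z b c‖ ^ 2 ≤
            lam * (∑ b, ∑ c, ‖∑ l, d l * u l b * v l c‖ ^ 2) *
              ∑ k, p k * ‖∑ b, ∑ c, φ k b * ψ k c * z b c‖ ^ 2)
    (N : ℕ) [Fact (Nat.Prime N)] (hN : N ≠ 2) :
    (N : ℝ) ^ (3 / 2 : ℝ) / (Real.sqrt 2 * C) ≤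
      (algBorderRank (fun k b c : ZMod N =>
          if b = c + k then (ZMod.stdAddChar (k ^ 2 * c) : ℂ) else 0) : ℝ) ^ (3 / 2 - δ') := by
  classical
  set Zc : ZMod N → ZMod N → ZMod N → ℂ := fun k b c =>
    if b = c + k then (ZMod.stdAddChar (k ^ 2 * c) : ℂ) else 0 with hZc
  set R : ℕ := algBorderRank Zc with hR
  set pad : (ZMod N → ZMod N → ZMod N → ℂ) →
      (ZMod N × ZMod N → ZMod N × ZMod N → ZMod N × ZMod N → ℂ) :=
    fun T a b c => if a.2 = 0 ∧ b.2 = 0 ∧ c.2 = 0 then T a.1 b.1 c.1 else 0 with hpad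
  have hcont : Continuous pad := by
    refine continuous_pi fun a => continuous_pi fun b => continuous_pi fun c => ?_
    by_cases h : a.2 = 0 ∧ b.2 = 0 ∧ c.2 = 0
    · simp only [hpad, h, and_self, if_true]
      fun_prop
    · simp only [hpad, h, if_false]
      exact continuous_const
  have hcl : Zc ∈ closure {T : ZMod N → ZMod N → ZMod N → ℂ | tensorRank T ≤ R} :=
    (mem_closure_setOf_tensorRank_le_iff alder_secantVariety_eq_setOf_algBorderRank_le_holds R Zc).2 le_rfl
  have hclp : pad Zc ∈ closure {S : ZMod N × ZMod N → ZMod N × ZMod N → ZMod N × ZMod N → ℂ |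
      tensorRank S ≤ R} := by
    have h1 : pad Zc ∈ closure (pad '' {T : ZMod N → ZMod N → ZMod N → ℂ | tensorRank T ≤ R}) :=
      image_closure_subset_closure_image hcont ⟨Zc, hcl, rfl⟩
    refine closure_mono ?_ h1
    rintro _ ⟨T, hT, rfl⟩
    exact (tensorRank_pad_le T 0 0 0).trans hT
  set Zp := pad Zc with hZp
  set K : ℝ := C * (R : ℝ) ^ (3 / 2 - δ') * Real.sqrt (2 * N - 1) with hK
  have hclosed : IsClosed {S : ZMod N × ZMod N → ZMod N × ZMod N → ZMod N × ZMod N → ℂ |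
      ‖∑ a, ∑ b, ∑ c, S a b c * conj (Zp a b c)‖ ^ 2 ≤ K * ∑ a, ∑ b, ∑ c, ‖S a b c‖ ^ 2} := by
    apply isClosed_le
    · fun_prop
    · fun_prop
  have hsub : {S : ZMod N × ZMod N → ZMod N × ZMod N → ZMod N × ZMod N → ℂ | tensorRank S ≤ R} ⊆
      {S | ‖∑ a, ∑ b, ∑ c, S a b c * conj (Zp a b c)‖ ^ 2 ≤ K * ∑ a, ∑ b, ∑ c, ‖S a b c‖ ^ 2} := by
    intro S hS
    exact chirpPad_pairing_le hRG N hN R S hS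
  have hat : ‖∑ a, ∑ b, ∑ c, Zp a b c * conj (Zp a b c)‖ ^ 2 ≤ K * ∑ a, ∑ b, ∑ c, ‖Zp a b c‖ ^ 2 :=
    closure_minimal hsub hclosed hclp
  exact chirp_selfPairing_arith hC (Real.rpow_nonneg (Nat.cast_nonneg _) _) hN hat

end Summit.MatrixMultiplication.MatrixMultiplication.Theorems
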